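import Summits.AtomisticToContinuum.Crystallization.Theorems.OverbindingBudgetAffineFarFieldCollarLocal
import Summits.AtomisticToContinuum.Crystallization.Theorems.OverbindingBudgetAffineFarFieldCellFacetsRows

/-!
# Overbinding budget, affine far field — the collar ASSEMBLY: the interface row in one theorem

Support file for `Summit.AtomisticToContinuum.Crystallization.Theses.OverbindingBudget.RobustDefectLimitWindows`
(sub-problem (2c), leaf SW♭(30), part 27V «Voronoi-cell quadrature of the far field», INTERFACE ROW, design (R*)
«reference frontier» of record).  The wiring memo WIRING-27Vc made Lean: the collar estimate of «Collar» (T5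
`abs_setIntegral_sub_le_sum`), the star-width bookkeeping of «CollarLocal» (`symmDiff_subset_biUnion_cthickening`,
`star_of_dist`) and the rows-sharp tube book of «CellFacetsRows» (`volume_cthickening_image_box_le`) composed into

* §0 `frontier_subset_biUnion_pairs`: the PIECE FAMILY — the reference collar frontier is covered by the contact
  sets of the pairs (core site, non-core site) at distance `≤ 2 r₀` (`r₀` the cells' circumradius), atlas-indexed.
* §1 ★ `interfaceRow_le`: for a reference tessellation `K₁`, an actual tessellation `K₂` covering space, a core
  index set `C`, a finite family of frontier PIECES `S k` with WIDTHS `W k` such that (i) the pieces cover the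
  reference collar frontier, (ii) core / outer actual cells leaving / entering the reference core union are
  `w i`-near their reference cells, (iii) outer reference cells touching lie outside, (iv) a piece meeting the
  `2 w i`-neighbourhood of `K₁ i` has `w i ≤ W k` (the STAR condition), and a kernel `g` with `|g| ≤ c k` on the
  `W k`-tube of `S k` whose volume is `≤ V k`:  `|∫_{⋃_C K₂} g − ∫_{⋃_C K₁} g| ≤ Σ_k c k · V k`.
  `interfaceRow_le_of_dist` is the same with (iv) replaced by its centre-distance form (`star_of_dist`).
* §2 the two VOLUME BOOKS `V k` of design (R*): ★ `facetPiece_volume_le` — a piece inside the placed cap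
  `q + G(K₀ ∩ {β ≤ ⟪y, u⟫})` of a cell whose cap lies in a prism `p + T(box)` with dual rows `R` has
  `vol(W-tube) ≤ |det T|·∏ (hᵢ − lᵢ + 2‖Rᵢ‖W)`; `pointPiece_volume_le` — a piece inside `{m}` has `vol(W-tube) ≤ (4/3)πW³`.

Everything is atlas-free; the atlas supplies the pieces (pairs of a core and a non-core reference site at bond or
√2-contact distance), the widths (star maxima of the F1 nearness `w(L)`), the nearness off/on the band («CollarBand»)
and the cap packages («CellFacets»/«CellFacetsHCP»/«CellFacetsRows»).

[this file; Conway–Sloane, Sphere Packings ch. 2, 21 (Voronoi cells of packings)]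
-/

namespace Summit.AtomisticToContinuum.Crystallization.Theorems.OverbindingBudgetAffineFarFieldCollarAssembly

noncomputable section

open Set MeasureTheory Metric
open Literature.Barriers.AtomisticToContinuum (voronoiCell)
open Summit.AtomisticToContinuum.Crystallization.Theorems.OverbindingBudgetAffineFarFieldCollar
open Summit.AtomisticToContinuum.Crystallization.Theorems.OverbindingBudgetAffineFarFieldCollarLocal
open Summit.AtomisticToContinuum.Crystallization.Theorems.OverbindingBudgetAffineFarFieldCellFacets
open Summit.AtomisticToContinuum.Crystallization.Theorems.OverbindingBudgetAffineFarFieldCellFacetsRows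

local notation "E3" => EuclideanSpace ℝ (Fin 3)

/-! ## §0 The piece family: pairs of a core and a non-core site within `2 r₀` -/

/-- ★ support (T2, atlas-indexed): for reference sites `qref : ι → E3` (locally finite range) whose Voronoi cells have
circumradius `≤ r₀`, the frontier of the core union `⋃_{i∈C}` is covered by the contact sets of the PAIRS `(i, j)`,
`i ∈ C`, `j ∉ C`, `dist (qref i) (qref j) ≤ 2 r₀` — any finite set `I` of pairs containing them will do (farther pairs
have disjoint cells, `CollarLocal.inter_voronoiCell_eq_empty`).  For the Barlow reference tessellation
(`r₀ = ν/√2`): the bonded pairs and the √2-contacts. [this file] -/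
theorem frontier_subset_biUnion_pairs {ι : Type*} (qref : ι → E3) {C : Set ι} (I : Finset (ι × ι)) {r₀ : ℝ}
    (hZ : ∀ (p : E3) (r : ℝ), (range qref ∩ closedBall p r).Finite)
    (hK : ∀ i, ∀ x ∈ voronoiCell (range qref) (qref i), dist x (qref i) ≤ r₀)
    (hI : ∀ i ∈ C, ∀ j ∉ C, dist (qref i) (qref j) ≤ 2 * r₀ → (i, j) ∈ I) :
    frontier (⋃ i ∈ C, voronoiCell (range qref) (qref i)) ⊆
      ⋃ p ∈ (I : Set (ι × ι)), voronoiCell (range qref) (qref p.1) ∩ voronoiCell (range qref) (qref p.2) := by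
  have hC : qref '' C ⊆ range qref := image_subset_range _ _
  have e : (⋃ i ∈ C, voronoiCell (range qref) (qref i)) = ⋃ z ∈ qref '' C, voronoiCell (range qref) z :=
    (biUnion_image).symm
  intro x hx
  rw [e] at hx
  obtain ⟨⟨z, w⟩, hzw, hxzw⟩ := mem_iUnion₂.1 (frontier_subset_biUnion_prod hZ hC hx)
  obtain ⟨⟨i, hi, rfl⟩, ⟨j, rfl⟩, hjC⟩ := mem_prod.1 hzw
  have hj : j ∉ C := fun hj => hjC (mem_image_of_mem qref hj)
  rcases le_or_gt (dist (qref i) (qref j)) (2 * r₀) with hle | hlt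
  · exact mem_biUnion (Finset.mem_coe.2 (hI i hi j hj hle)) hxzw
  · exfalso
    have hempty := inter_voronoiCell_eq_empty (mem_range_self i) (mem_range_self j) (hK i) hlt
    rw [hempty] at hxzw
    exact hxzw

/-! ## §1 The interface row -/

/-- ★★ THE INTERFACE ROW (design (R*)): collar estimate + star-width bookkeeping + piece books. With pieces
`S k`, widths `W k`, kernel bounds `c k ≥ 0` on the `W k`-tubes and volume books `V k` of the tubes:
`|∫_{⋃_{i∈C} K₂ i} g − ∫_{⋃_{i∈C} K₁ i} g| ≤ Σ_{k∈I} c k · V k`. Hypotheses `hS`, `hcov`, `h`, `h'`, `hout`, `hstar` are those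
of `CollarLocal.symmDiff_subset_biUnion_cthickening`; the measure-side ones those of `Collar.abs_setIntegral_sub_le_sum`.
[this file] -/
theorem interfaceRow_le {ι κ : Type*} {C : Set ι} {K₁ K₂ : ι → Set E3} {w : ι → ℝ} {g : E3 → ℝ}
    (I : Finset κ) (S : κ → Set E3) (W V c : κ → ℝ)
    (hS : frontier (⋃ j ∈ C, K₁ j) ⊆ ⋃ k ∈ (I : Set κ), S k) (hcov : ⋃ i, K₂ i = univ)
    (h : ∀ i ∈ C, ∀ x ∈ K₂ i, x ∉ ⋃ j ∈ C, K₁ j → ∃ x' ∈ K₁ i, dist x x' ≤ w i)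
    (h' : ∀ i ∉ C, ∀ x ∈ K₂ i, x ∈ ⋃ j ∈ C, K₁ j → ∃ x' ∈ K₁ i, dist x x' ≤ w i)
    (hout : ∀ i ∉ C, (K₂ i ∩ ⋃ j ∈ C, K₁ j).Nonempty → K₁ i ⊆ closure (⋃ j ∈ C, K₁ j)ᶜ)
    (hstar : ∀ i, ∀ k ∈ (I : Set κ), (S k ∩ cthickening (2 * w i) (K₁ i)).Nonempty → w i ≤ W k)
    (hA : MeasurableSet (⋃ i ∈ C, K₁ i)) (hB : MeasurableSet (⋃ i ∈ C, K₂ i))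
    (hgA : IntegrableOn g (⋃ i ∈ C, K₁ i)) (hgB : IntegrableOn g (⋃ i ∈ C, K₂ i))
    (hgP : ∀ k ∈ I, IntegrableOn g (cthickening (W k) (S k)))
    (hSb : ∀ k ∈ I, Bornology.IsBounded (S k))
    (hV : ∀ k ∈ I, (volume (cthickening (W k) (S k))).toReal ≤ V k)
    (hc : ∀ k ∈ I, ∀ x ∈ cthickening (W k) (S k), |g x| ≤ c k) (hc0 : ∀ k ∈ I, 0 ≤ c k) :
    |(∫ x in ⋃ i ∈ C, K₂ i, g x) - ∫ x in ⋃ i ∈ C, K₁ i, g x| ≤ ∑ k ∈ I, c k * V k := by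
  have hsub : symmDiff (⋃ i ∈ C, K₁ i) (⋃ i ∈ C, K₂ i) ⊆ ⋃ k ∈ I, cthickening (W k) (S k) :=
    symmDiff_subset_biUnion_cthickening (I : Set κ) S W hS hcov h h' hout hstar
  have hT5 := abs_setIntegral_sub_le_sum I (fun k => cthickening (W k) (S k)) c hA hB hgA hgB
    (fun k _ => isClosed_cthickening.measurableSet) hgP
    (fun k hk => (hSb k hk).cthickening.measure_lt_top) hsub hc
  refine hT5.trans (Finset.sum_le_sum fun k hk => ?_)
  exact mul_le_mul_of_nonneg_left (hV k hk) (hc0 k hk)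

/-- ★ THE INTERFACE ROW, centre-distance form of the star condition: reference cells in balls
`closedBall (q i) (r i)`, pieces in balls `closedBall (m k) (ρ k)`, and `w i ≤ W k` whenever
`dist (q i) (m k) ≤ r i + 2 w i + ρ k` (an enumeration the atlas decides by integer arithmetic). [this file] -/
theorem interfaceRow_le_of_dist {ι κ : Type*} {C : Set ι} {K₁ K₂ : ι → Set E3} {w : ι → ℝ} {g : E3 → ℝ}
    (I : Finset κ) (S : κ → Set E3) (W V c : κ → ℝ) {q : ι → E3} {r : ι → ℝ} {m : κ → E3} {ρ : κ → ℝ}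
    (hS : frontier (⋃ j ∈ C, K₁ j) ⊆ ⋃ k ∈ (I : Set κ), S k) (hcov : ⋃ i, K₂ i = univ)
    (h : ∀ i ∈ C, ∀ x ∈ K₂ i, x ∉ ⋃ j ∈ C, K₁ j → ∃ x' ∈ K₁ i, dist x x' ≤ w i)
    (h' : ∀ i ∉ C, ∀ x ∈ K₂ i, x ∈ ⋃ j ∈ C, K₁ j → ∃ x' ∈ K₁ i, dist x x' ≤ w i)
    (hout : ∀ i ∉ C, (K₂ i ∩ ⋃ j ∈ C, K₁ j).Nonempty → K₁ i ⊆ closure (⋃ j ∈ C, K₁ j)ᶜ)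
    (hw : ∀ i, 0 ≤ w i) (hK : ∀ i, K₁ i ⊆ closedBall (q i) (r i))
    (hSm : ∀ k ∈ (I : Set κ), S k ⊆ closedBall (m k) (ρ k))
    (hWd : ∀ i, ∀ k ∈ (I : Set κ), dist (q i) (m k) ≤ r i + 2 * w i + ρ k → w i ≤ W k)
    (hA : MeasurableSet (⋃ i ∈ C, K₁ i)) (hB : MeasurableSet (⋃ i ∈ C, K₂ i))
    (hgA : IntegrableOn g (⋃ i ∈ C, K₁ i)) (hgB : IntegrableOn g (⋃ i ∈ C, K₂ i))
    (hgP : ∀ k ∈ I, IntegrableOn g (cthickening (W k) (S k)))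
    (hV : ∀ k ∈ I, (volume (cthickening (W k) (S k))).toReal ≤ V k)
    (hc : ∀ k ∈ I, ∀ x ∈ cthickening (W k) (S k), |g x| ≤ c k) (hc0 : ∀ k ∈ I, 0 ≤ c k) :
    |(∫ x in ⋃ i ∈ C, K₂ i, g x) - ∫ x in ⋃ i ∈ C, K₁ i, g x| ≤ ∑ k ∈ I, c k * V k :=
  interfaceRow_le I S W V c hS hcov h h' hout (star_of_dist hw hK hSm hWd) hA hB hgA hgB hgP
    (fun k hk => isBounded_closedBall.subset (hSm k hk)) hV hc hc0

/-! ## §2 The two volume books -/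

/-- ★ FACET PIECE BOOK (rows-sharp): a piece `S` inside the placed cap `q + G(K₀ ∩ {β ≤ ⟪y, u⟫})` (`G` a linear
isometry) of a cell whose cap lies in the prism `p + T(box [l, h])` with dual rows `R` (`⟪Rᵢ, T x⟫ = xᵢ`, `T` onto)
has, for `0 ≤ W` and `l ≤ h`, `vol(cthickening W S) ≤ |det T|·∏ᵢ (hᵢ − lᵢ + 2‖Rᵢ‖W)`. For a collar facet at
relative depth `0`: `|det T_F|·(1 + 2‖R₀‖W)(1 + 2‖R₁‖W)·2‖R₂‖W`. [this file] -/
theorem facetPiece_volume_le {S K₀ : Set E3} {q p u : E3} (G : E3 ≃ₗᵢ[ℝ] E3) {β : ℝ} {T : E3 →L[ℝ] E3}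
    {R : Fin 3 → E3} {l h : Fin 3 → ℝ} (hS : S ⊆ (fun y => q + G y) '' (K₀ ∩ {y | β ≤ inner ℝ y u}))
    (hcap : K₀ ∩ {y | β ≤ inner ℝ y u} ⊆ (fun x => p + T x) '' {x : E3 | ∀ i, l i ≤ x i ∧ x i ≤ h i})
    (hR : ∀ x i, inner ℝ (R i) (T x) = x i) (hsurj : Function.Surjective T) (hlh : ∀ i, l i ≤ h i)
    {W : ℝ} (hW : 0 ≤ W) :
    (volume (cthickening W S)).toReal ≤ |T.det| * ∏ i, (h i - l i + 2 * (‖R i‖ * W)) := by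
  set T' : E3 →L[ℝ] E3 := G.toLinearIsometry.toContinuousLinearMap.comp T with hT'
  have hG : ∀ v, ‖G.toLinearIsometry.toContinuousLinearMap v‖ = ‖v‖ := fun v => G.norm_map v
  -- the piece inside the transported prism
  have hS' : S ⊆ (fun x => (q + G p) + T' x) '' {x : E3 | ∀ i, l i ≤ x i ∧ x i ≤ h i} := by
    refine hS.trans ?_
    rintro _ ⟨y, hy, rfl⟩
    obtain ⟨b, hb, hby⟩ := hcap hy
    refine ⟨b, hb, ?_⟩
    show (q + G p) + (G.toLinearIsometry.toContinuousLinearMap.comp T) b = q + G y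
    rw [← hby, ContinuousLinearMap.comp_apply, isometry_clm_apply, map_add, add_assoc]
  have hR' : ∀ x i, inner ℝ (G (R i)) (T' x) = x i := rows_comp_isometry G hR
  have hlow : Function.Surjective T' := by
    intro v
    obtain ⟨x, hx⟩ := hsurj (G.symm v)
    refine ⟨x, ?_⟩
    show G.toLinearIsometry.toContinuousLinearMap (T x) = v
    rw [isometry_clm_apply, hx, LinearIsometryEquiv.apply_symm_apply]
  have hdet : |T'.det| = |T.det| := abs_det_comp_of_norm_eq_left _ _ hG
  have hbook := volume_cthickening_image_box_le T' (q + G p) (fun i => G (R i)) hR' hlow l h hlh hW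
  simp only [LinearIsometryEquiv.norm_map] at hbook
  rw [hdet] at hbook
  have hc : IsCompact (cthickening W ((fun x => (q + G p) + T' x) '' {x : E3 | ∀ i, l i ≤ x i ∧ x i ≤ h i})) :=
    ((isCompact_coordBox_fin3 l h).image (by fun_prop)).cthickening
  exact (ENNReal.toReal_mono hc.measure_lt_top.ne (measure_mono (cthickening_subset_of_subset W hS'))).trans
    hbook

/-- support: POINT PIECE BOOK — a piece inside a single point (a √2-contact of two reference cells) has
`vol(cthickening W S) ≤ (4/3)·π·W³`. [this file + «CollarLocal»] -/
theorem pointPiece_volume_le {S : Set E3} {m : E3} (hS : S ⊆ {m}) {W : ℝ} (hW : 0 ≤ W) :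
    (volume (cthickening W S)).toReal ≤ 4 / 3 * Real.pi * W ^ 3 := by
  rw [← toReal_volume_closedBall_three m hW]
  exact ENNReal.toReal_mono (isCompact_closedBall m W).measure_lt_top.ne
    (measure_mono (cthickening_subset_closedBall_of_subset_singleton hS hW))

/-- support: the DEPTH-ZERO facet box `[0,1]² × [0,0]` (relative depth `ε = 0` of «CellFacets») has sides
`(1, 1, 0)`, so the rows book reads `|det T|·(1 + 2‖R₀‖W)(1 + 2‖R₁‖W)·(2‖R₂‖W)`. [this file] -/
theorem facetBox_zero_book (d W : ℝ) (R : Fin 3 → E3) :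
    d * ∏ i, (![1 + 0 / 2, 1 + 0 / 2, 0] i - ![-(0 / 2), -(0 / 2), -0] i + 2 * (‖R i‖ * W)) =
      d * ((1 + 2 * (‖R 0‖ * W)) * (1 + 2 * (‖R 1‖ * W)) * (2 * (‖R 2‖ * W))) := by
  rw [Fin.prod_univ_three]
  simp only [Matrix.cons_val_zero, Matrix.cons_val_one, Matrix.cons_val_two, Matrix.head_cons,
    Matrix.tail_cons]
  ring

end

end Summit.AtomisticToContinuum.Crystallization.Theorems.OverbindingBudgetAffineFarFieldCollarAssembly
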